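import Literature.MathematicalPhysics.KineticTheory.HardSphereDuhamelNullSets
import HarnessLib

/-!
# The iterated Duhamel formula of the hard-sphere hierarchy up to null sets, from the one-step
# hierarchy at generic and at contact configurations
(Bodineau–Gallagher–Saint-Raymond, Invent. Math. 203 (2016) = arXiv:1305.3397v2, §3.1 p. 9: "the
iterated Duhamel formula `f_N^{(s)}(t) = ∑_n ∫…∫ S_s(t-t₁) C_{s,s+1} S_{s+1}(t₁-t₂) ⋯ f_N^{(s+n)}(0)`"
and Remark 3.1; Spohn 2006 Thm 11 / Cor. 12; Cercignani–Illner–Pulvirenti 1994 (4.7) "for almost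
all `z^s`"; trunk T-KINETIC, topic MathematicalPhysics/KineticTheory; the Duhamel-algebra half of
the input (S) of `bgsr_linearBoltzmannApprox_of_domainInputs` (`TaggedSphereLinearBoltzmannInputs`)
and of the sectorwise iterated Duhamel formula of `LanfordReduction`.)

The input (S) of the BGSR programme (and of Lanford's theorem in the tree) asks that a family
`f^{(k)}(t)` of functions on the `k`-particle phase spaces — the marginals of a transported
hard-sphere density along the regularised flows — agree Lebesgue-a.e., at every level and time
`t ≥ 0`, with the finite Duhamel series of its initial value for the hard-sphere hierarchy model
`hsHierarchyModel` (`HierarchyModel.seriesFamily`). In print this is obtained by ITERATING the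
one-step integrated hierarchy `f^{(k)}(t) = S_k(t) f^{(k)}(0) + ∫_0^t S_k(t-τ) C_{k,k+1} f^{(k+1)}(τ) dτ`.
For hard spheres the iteration is not formal (BGSR Remark 3.1): the collision operator reads
`f^{(k+1)}(τ)` on the contact set, a Lebesgue-null set, so the one-step identity "for almost every
configuration" cannot be substituted into the collision operator. What CAN be iterated is the
pair of statements

* (H1) the one-step identity at Lebesgue-almost every configuration, every level and `t ≥ 0`;
* (H1♯) the one-step identity AT THE OUTGOING ADJOINED CONTACT CONFIGURATIONS
  `outRep_i (adj Y i ω v)` read by the collision operators, at almost every time `τ > 0`, almost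
  every `Y` and `σ ⊗ dv`-almost every weighted `(ω, v)` with the adjoined configuration in the
  domain (the trace form of the hierarchy: CIP 1994 assumption (3.4)/(4.3.4), Spohn 2006 (8)),

and this file PROVES (S) from (H1), (H1♯) for any jointly-measurable, Gaussian-bounded family
`f` vanishing above a level `Nmax` and off the hard-sphere domains, GIVEN the non-singularity
predicates `GainPullback ε`, `LossPullback ε` of `HardSphereDuhamelNullSets` (proved in
`HardSphereAdjunctionPullback`). The proof introduces the *remainder terms*
`R_0^{(k)}(t) = f^{(k)}(t)`, `R_{n+1}^{(k)}(t) = ∫_0^t S_k(t-τ) C^{out}_{k,k+1} R_n^{(k+1)}(τ) dτ`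
(`HierarchyModel.remainderTerm`, the `n`-fold collision integral of `f`) and shows, exactly as in
`HardSphereDuhamelNullSets` (induction on the collision sources, transfers along the
quasi-measure-preserving transported adjunctions, the time shear and the measure-preserving map
`(Z, τ) ↦ (τ, Φ_{τ-t} Z)`), that `R_n^{(s)}(t) = Q_{s,s+n}(t) f(0) + R_{n+1}^{(s)}(t)` a.e.;
telescoping and the vanishing of `R_{Nmax+1}` give (S).

* §1 `HierarchyModel.remainderTerm` (abstract), its niceness, vanishing above `Nmax`; for hard
  spheres, vanishing off the domains;
* §2 `ae_transfer_along_pullback` — the transfer lemma of `HardSphereDuhamelNullSets`, for two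
  arbitrary functions of (time, configuration);
* §3 `hs_remainderSource_ae_eq` — the source induction;
* §4 `hs_remainderTerm_ae_eq`, `hs_ae_eq_sum_add_remainderTerm`,
  `hs_seriesFamily_ae_eq_of_oneStep` — **(S) from (H1), (H1♯)** (and the pull-back predicates).

## References

* T. Bodineau, I. Gallagher, L. Saint-Raymond, *The Brownian motion as the limit of a
  deterministic system of hard-spheres*, Invent. Math. 203 (2016) 493–553 = arXiv:1305.3397v2,
  §3.1 (iterated Duhamel formula, Remark 3.1), p. 9.
* H. Spohn, *On the integrated form of the BBGKY hierarchy for hard spheres*,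
  arXiv:math-ph/0605068, (8), Thm 11, Cor. 12.
* C. Cercignani, R. Illner, M. Pulvirenti, *The Mathematical Theory of Dilute Gases*, Springer
  (1994), §4.3 (4.3.4), Thm 4.3.1, §4.4 (4.7).
-/

open MeasureTheory MeasureTheory.Measure Metric Real Set Filter Function
open scoped InnerProductSpace ENNReal
open Literature.Analysis.FluidPDE (Config configEnergy GCState duhamelTerm duhamelTerm_zero
  duhamelTerm_succ Geometry hardSphereDomain lossConfig gainConfig)

namespace Literature.MathematicalPhysics.KineticTheory

noncomputable section

set_option synthInstance.maxSize 1024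

section Kinetic

variable {d : Type*} [Fintype d]

attribute [local instance] sigmaFinite_volume_phaseSpace

/-! ## §1. The remainder terms -/

namespace HierarchyModel

variable {X : Type*} [MeasurableSpace X] (M : HierarchyModel d X)

/-- The *remainder terms* of a time-dependent family `f^{(k)}(t)` for the hierarchy `M`:
`R_0^{(k)}(t) = f^{(k)}(t)` and `R_{n+1}^{(k)}(t) = ∫_0^t S_k(t - τ) C_k R_n^{(k+1)}(τ) dτ` — the
`n`-fold iterated collision integral of `f`, the term left over after `n` substitutions of the
one-step integrated hierarchy into itself (BGSR §3.1; Spohn 2006 Thm 11). [cite: BodineauGallagherSaintRaymondInvent2016, §3.1, p. 9] -/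
def remainderTerm (f : (k : ℕ) → ℝ → Config k d X → ℝ) : ℕ → (k : ℕ) → ℝ → Config k d X → ℝ
  | 0, k, t => f k t
  | n + 1, k, t => fun Z => ∫ τ in (0 : ℝ)..t, M.transport k (t - τ) (M.op k (remainderTerm f n (k + 1) τ)) Z

variable (f : (k : ℕ) → ℝ → Config k d X → ℝ)

/-- The order-`0` remainder is the family itself. [folklore] -/
@[simp]
theorem remainderTerm_zero (k : ℕ) (t : ℝ) : M.remainderTerm f 0 k t = f k t := rfl

/-- The recursion of the remainder terms. [folklore] -/
theorem remainderTerm_succ (n k : ℕ) (t : ℝ) (Z : Config k d X) :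
    M.remainderTerm f (n + 1) k t Z =
      ∫ τ in (0 : ℝ)..t, M.transport k (t - τ) (M.op k (M.remainderTerm f n (k + 1) τ)) Z := rfl

/-- The order-`1` remainder is the one-step collision integral of `f`. [folklore] -/
theorem remainderTerm_one (k : ℕ) (t : ℝ) (Z : Config k d X) :
    M.remainderTerm f 1 k t Z = ∫ τ in (0 : ℝ)..t, M.transport k (t - τ) (M.op k (f (k + 1) τ)) Z := rfl

variable {f}

/-- The remainder terms of a nice time-dependent family are nice, locally uniformly in time
(`isNiceT_duhamelStep`). [folklore] -/
theorem isNiceT_remainderTerm (hf : ∀ (k : ℕ) (T : ℝ), IsNiceT T (f k)) (n : ℕ) :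
    ∀ (k : ℕ) (T : ℝ), IsNiceT T (fun t => M.remainderTerm f n k t) := by
  induction n with
  | zero => intro k T; exact hf k T
  | succ n ih => intro k T; exact isNiceT_duhamelStep M (ih (k + 1) T)

/-- Remainder terms reaching above the top level vanish: if `f^{(k)} = 0` for `k > Nmax` then
`R_n^{(k)}(t) = 0` whenever `k + n > Nmax`. [folklore] -/
theorem remainderTerm_eq_zero_of_lt {Nmax : ℕ} (hfN : ∀ k, Nmax < k → ∀ t, f k t = 0) (n : ℕ) :
    ∀ (k : ℕ) (t : ℝ), Nmax < k + n → M.remainderTerm f n k t = 0 := by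
  induction n with
  | zero => intro k t hk; exact hfN k (by omega) t
  | succ n ih =>
    intro k t hk
    funext Z
    rw [remainderTerm_succ]
    have h0 : ∀ τ, M.remainderTerm f n (k + 1) τ = 0 := fun τ => ih (k + 1) τ (by omega)
    simp only [h0, op_zero, transport_apply, Pi.zero_apply]
    simp

end HierarchyModel

section HardSpheres

variable {ε : ℝ} (hε : 0 < ε) (hε' : ε < 2⁻¹) (Ntot : ℕ) {f : (k : ℕ) → ℝ → Config k d (UnitAddTorus d) → ℝ}

/-- For the hard-sphere model, the remainder terms of a family vanishing off the hard-sphere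
domains vanish off the hard-sphere domains (the regularised flow fixes such configurations and
`outBbgkyOp_eq_zero_of_not_mem`). [folklore] -/
theorem remainderTerm_hs_eq_zero_of_not_mem
    (hfD : ∀ (k : ℕ) (t : ℝ), ∀ Z ∉ hardSphereDomain (Literature.Analysis.FluidPDE.Torus.geometry d) k ε, f k t Z = 0)
    (n : ℕ) : ∀ (k : ℕ) (t : ℝ), ∀ Z ∉ hardSphereDomain (Literature.Analysis.FluidPDE.Torus.geometry d) k ε,
      (hsHierarchyModel (d := d) hε hε' Ntot).remainderTerm f n k t Z = 0 := by
  induction n with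
  | zero => intro k t Z hZ; exact hfD k t Z hZ
  | succ n ih =>
    intro k t Z hZ
    rw [HierarchyModel.remainderTerm_succ]
    refine intervalIntegral.integral_zero_ae (Eventually.of_forall fun τ _ => ?_)
    rw [HierarchyModel.transport_apply, hsHierarchyModel_flow_of_not_mem hε hε' Ntot hZ, hsHierarchyModel_op]
    exact outBbgkyOp_eq_zero_of_not_mem Ntot (fun Z' hZ' => ih (k + 1) τ Z' hZ') hZ

/-! ## §2. The transfer lemma -/

/-- **Transfer of an a.e. statement about (time, configuration) pairs along a transported
adjunction**: if `K₁ = K₂` for `dτ' dW`-a.e. `(τ', W)` with `τ' > 0`, and `Λ` is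
quasi-measure-preserving from the parameters `((u, Y), q)` restricted to a measurable `S`, then
for a.e. `(τ, Y)`, a.e. `q` and a.e. `τ'`, whenever `((τ - τ', Y), q) ∈ S` and `τ' > 0`,
`K₁ (τ', Λ((τ - τ', Y), q)) = K₂ (τ', Λ((τ - τ', Y), q))` (quasi-measure-preservation of
`(p, τ') ↦ (τ', Λ p)`, the time shear `measurePreserving_timeShear`, Fubini). [folklore] -/
theorem ae_transfer_along_pullback {s : ℕ} {K₁ K₂ : ℝ × Config (s + 1) d (UnitAddTorus d) → ℝ}
    (ih : ∀ᵐ y : ℝ × Config (s + 1) d (UnitAddTorus d) ∂((volume : Measure ℝ).prod volume), 0 < y.1 → K₁ y = K₂ y)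
    {Λ : (ℝ × Config s d (UnitAddTorus d)) × (sphere (0 : EuclideanSpace ℝ d) 1 × EuclideanSpace ℝ d) →
      Config (s + 1) d (UnitAddTorus d)}
    {S : Set ((ℝ × Config s d (UnitAddTorus d)) × (sphere (0 : EuclideanSpace ℝ d) 1 × EuclideanSpace ℝ d))}
    (hS : MeasurableSet S)
    (hΛ : QuasiMeasurePreserving Λ
      ((((volume : Measure ℝ).prod (volume : Measure (Config s d (UnitAddTorus d)))).prod
        ((sphereMeasure (E := EuclideanSpace ℝ d)).prod (volume : Measure (EuclideanSpace ℝ d)))).restrict S) volume) :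
    ∀ᵐ y : ℝ × Config s d (UnitAddTorus d) ∂((volume : Measure ℝ).prod volume),
      ∀ᵐ q : sphere (0 : EuclideanSpace ℝ d) 1 × EuclideanSpace ℝ d
        ∂((sphereMeasure (E := EuclideanSpace ℝ d)).prod volume),
      ∀ᵐ τ' : ℝ, ((y.1 - τ', y.2), q) ∈ S → 0 < τ' → K₁ (τ', Λ ((y.1 - τ', y.2), q)) =
        K₂ (τ', Λ ((y.1 - τ', y.2), q)) := by
  set μP : Measure ((ℝ × Config s d (UnitAddTorus d)) × (sphere (0 : EuclideanSpace ℝ d) 1 × EuclideanSpace ℝ d)) :=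
    ((volume : Measure ℝ).prod (volume : Measure (Config s d (UnitAddTorus d)))).prod
      ((sphereMeasure (E := EuclideanSpace ℝ d)).prod (volume : Measure (EuclideanSpace ℝ d))) with hμP
  haveI : IsFiniteMeasure (sphereMeasure (E := EuclideanSpace ℝ d)) :=
    Literature.Analysis.FluidPDE.isFiniteMeasure_sphereMeasure
  haveI : SFinite μP := by rw [hμP]; infer_instance
  have h1 : QuasiMeasurePreserving
      (fun z : ((ℝ × Config s d (UnitAddTorus d)) × (sphere (0 : EuclideanSpace ℝ d) 1 × EuclideanSpace ℝ d)) × ℝ =>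
        ((z.2, Λ z.1) : ℝ × Config (s + 1) d (UnitAddTorus d)))
      ((μP.restrict S).prod (volume : Measure ℝ)) ((volume : Measure ℝ).prod volume) := by
    have hsw := (measurePreserving_swap (μ := (volume : Measure (Config (s + 1) d (UnitAddTorus d))))
      (ν := (volume : Measure ℝ))).quasiMeasurePreserving
    have hpm := QuasiMeasurePreserving.prodMap hΛ (QuasiMeasurePreserving.id (volume : Measure ℝ))
    exact hsw.comp hpm
  have h2 := h1.ae ih
  have hm : (μP.restrict S).prod (volume : Measure ℝ) = (μP.prod volume).restrict (S ×ˢ (univ : Set ℝ)) := by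
    rw [← Measure.prod_restrict, Measure.restrict_univ]
  rw [hm] at h2
  have h3 := (ae_restrict_iff' (hS.prod MeasurableSet.univ)).1 h2
  have h4 := (measurePreserving_timeShear (volume : Measure (Config s d (UnitAddTorus d)))
    ((sphereMeasure (E := EuclideanSpace ℝ d)).prod (volume : Measure (EuclideanSpace ℝ d)))).quasiMeasurePreserving.ae h3
  have h5 := Measure.ae_ae_of_ae_prod (Measure.ae_ae_of_ae_prod h4)
  filter_upwards [h5] with y hy
  filter_upwards [hy] with q hq
  filter_upwards [hq] with τ' hτ' hS' h0
  exact hτ' ⟨hS', mem_univ _⟩ h0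

/-! ## §3. The source induction -/

/-- **Base case of the source induction**: by (H1♯) at level `k + 1`, for `dτ dY`-a.e. `(τ, Y)`
with `τ > 0`, the collision operator applied to `f^{(k+1)}(τ)` and to
`S_{k+1}(τ) f^{(k+1)}(0) + R_1^{(k+1)}(τ)` agree at `Y` (`outBbgkyOp_congr_of_ae`: both read their
argument at the outgoing adjoined configurations of the domain only).
[cite: BodineauGallagherSaintRaymondInvent2016, §3.1 Remark 3.1, p. 9] -/
theorem hs_remainderSource_ae_eq_zero
    (hfD : ∀ (k : ℕ) (t : ℝ), ∀ Z ∉ hardSphereDomain (Literature.Analysis.FluidPDE.Torus.geometry d) k ε, f k t Z = 0)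
    (hH : ∀ (k : ℕ) (i : Fin k), ∀ᵐ p : (ℝ × Config k d (UnitAddTorus d)) × (sphere (0 : EuclideanSpace ℝ d) 1 × EuclideanSpace ℝ d)
        ∂(((volume : Measure ℝ).prod (volume : Measure (Config k d (UnitAddTorus d)))).prod
          ((sphereMeasure (E := EuclideanSpace ℝ d)).prod (volume : Measure (EuclideanSpace ℝ d)))),
      (0 < p.1.1 → 0 < ⟪(p.2.1 : EuclideanSpace ℝ d), p.2.2 - (p.1.2 i).2⟫_ℝ →
        gainConfig (Literature.Analysis.FluidPDE.Torus.geometry d) ε p.1.2 i p.2.1 p.2.2 ∈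
          hardSphereDomain (Literature.Analysis.FluidPDE.Torus.geometry d) (k + 1) ε →
        f (k + 1) p.1.1 (outRep (Literature.Analysis.FluidPDE.Torus.geometry d) k i
            (gainConfig (Literature.Analysis.FluidPDE.Torus.geometry d) ε p.1.2 i p.2.1 p.2.2)) =
          (hsHierarchyModel (d := d) hε hε' Ntot).transport (k + 1) p.1.1 (f (k + 1) 0)
              (outRep (Literature.Analysis.FluidPDE.Torus.geometry d) k i
                (gainConfig (Literature.Analysis.FluidPDE.Torus.geometry d) ε p.1.2 i p.2.1 p.2.2)) +
            ∫ τ' in (0 : ℝ)..p.1.1, (hsHierarchyModel (d := d) hε hε' Ntot).transport (k + 1) (p.1.1 - τ')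
              ((hsHierarchyModel (d := d) hε hε' Ntot).op (k + 1) (f (k + 1 + 1) τ'))
              (outRep (Literature.Analysis.FluidPDE.Torus.geometry d) k i
                (gainConfig (Literature.Analysis.FluidPDE.Torus.geometry d) ε p.1.2 i p.2.1 p.2.2))) ∧
      (0 < p.1.1 → ⟪(p.2.1 : EuclideanSpace ℝ d), p.2.2 - (p.1.2 i).2⟫_ℝ < 0 →
        lossConfig (Literature.Analysis.FluidPDE.Torus.geometry d) ε p.1.2 i p.2.1 p.2.2 ∈
          hardSphereDomain (Literature.Analysis.FluidPDE.Torus.geometry d) (k + 1) ε →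
        f (k + 1) p.1.1 (outRep (Literature.Analysis.FluidPDE.Torus.geometry d) k i
            (lossConfig (Literature.Analysis.FluidPDE.Torus.geometry d) ε p.1.2 i p.2.1 p.2.2)) =
          (hsHierarchyModel (d := d) hε hε' Ntot).transport (k + 1) p.1.1 (f (k + 1) 0)
              (outRep (Literature.Analysis.FluidPDE.Torus.geometry d) k i
                (lossConfig (Literature.Analysis.FluidPDE.Torus.geometry d) ε p.1.2 i p.2.1 p.2.2)) +
            ∫ τ' in (0 : ℝ)..p.1.1, (hsHierarchyModel (d := d) hε hε' Ntot).transport (k + 1) (p.1.1 - τ')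
              ((hsHierarchyModel (d := d) hε hε' Ntot).op (k + 1) (f (k + 1 + 1) τ'))
              (outRep (Literature.Analysis.FluidPDE.Torus.geometry d) k i
                (lossConfig (Literature.Analysis.FluidPDE.Torus.geometry d) ε p.1.2 i p.2.1 p.2.2))))
    (k : ℕ) :
    ∀ᵐ y : ℝ × Config k d (UnitAddTorus d) ∂((volume : Measure ℝ).prod volume), 0 < y.1 →
      (hsHierarchyModel (d := d) hε hε' Ntot).op k ((hsHierarchyModel (d := d) hε hε' Ntot).remainderTerm f 0 (k + 1) y.1) y.2 =
        (hsHierarchyModel (d := d) hε hε' Ntot).op k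
          (duhamelTerm (hsHierarchyModel (d := d) hε hε' Ntot).transport (hsHierarchyModel hε hε' Ntot).op
              0 (k + 1) y.1 (fun a => f a 0) +
            (hsHierarchyModel (d := d) hε hε' Ntot).remainderTerm f 1 (k + 1) y.1) y.2 := by
  set M := hsHierarchyModel (d := d) hε hε' Ntot with hM
  haveI : IsFiniteMeasure (sphereMeasure (E := EuclideanSpace ℝ d)) :=
    Literature.Analysis.FluidPDE.isFiniteMeasure_sphereMeasure
  have hall := ae_all_iff.2 fun i => hH k i
  filter_upwards [Measure.ae_ae_of_ae_prod hall] with y hy hτ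
  have hv₁ : ∀ W ∉ hardSphereDomain (Literature.Analysis.FluidPDE.Torus.geometry d) (k + 1) ε,
      M.remainderTerm f 0 (k + 1) y.1 W = 0 := fun W hW => hfD (k + 1) y.1 W hW
  have hv₂ : ∀ W ∉ hardSphereDomain (Literature.Analysis.FluidPDE.Torus.geometry d) (k + 1) ε,
      (duhamelTerm M.transport M.op 0 (k + 1) y.1 (fun a => f a 0) + M.remainderTerm f 1 (k + 1) y.1) W = 0 := by
    intro W hW
    rw [Pi.add_apply, duhamelTerm_hsHierarchyModel_eq_zero_of_not_mem hε hε' Ntot (fun a Z hZ => hfD a 0 Z hZ) 0 (k + 1) y.1 W hW,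
      remainderTerm_hs_eq_zero_of_not_mem hε hε' Ntot hfD 1 (k + 1) y.1 W hW, add_zero]
  refine outBbgkyOp_congr_of_ae Ntot hv₁ hv₂ fun i => ?_
  filter_upwards [hy] with q hq
  obtain ⟨hqG, hqL⟩ := hq i
  constructor
  · intro hb hD
    rw [HierarchyModel.remainderTerm_zero, Pi.add_apply, duhamelTerm_zero, HierarchyModel.remainderTerm_one]
    exact hqG hτ hb hD
  · intro hb hD
    rw [HierarchyModel.remainderTerm_zero, Pi.add_apply, duhamelTerm_zero, HierarchyModel.remainderTerm_one]
    exact hqL hτ hb hD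

/-- **Induction step of the source induction**: if the collision sources built on `R_m^{(k+2)}`
and on `Q_{k+2,·}(·) f(0) + R_{m+1}^{(k+2)}` agree a.e. at level `k + 1`, then those built on
`R_{m+1}^{(k+1)}` and `Q + R_{m+2}^{(k+1)}` agree a.e. at level `k` (unfold one collision
integral at the outgoing adjoined configurations, `duhamelStep_add`; transfer the induction
hypothesis along the transported adjunctions, `ae_transfer_along_pullback` with `GainPullback`,
`LossPullback`; `outBbgkyOp_congr_of_ae`). [cite: BodineauGallagherSaintRaymondInvent2016, §3.1 Remark 3.1, p. 9] -/
theorem hs_remainderSource_ae_eq_succ (hCg : GainPullback (d := d) ε) (hCl : LossPullback (d := d) ε)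
    (hfT : ∀ (k : ℕ) (T : ℝ), IsNiceT T (f k))
    (hfD : ∀ (k : ℕ) (t : ℝ), ∀ Z ∉ hardSphereDomain (Literature.Analysis.FluidPDE.Torus.geometry d) k ε, f k t Z = 0)
    (m k : ℕ)
    (ih : ∀ᵐ y : ℝ × Config (k + 1) d (UnitAddTorus d) ∂((volume : Measure ℝ).prod volume), 0 < y.1 →
      (hsHierarchyModel (d := d) hε hε' Ntot).op (k + 1)
          ((hsHierarchyModel (d := d) hε hε' Ntot).remainderTerm f m (k + 1 + 1) y.1) y.2 =
        (hsHierarchyModel (d := d) hε hε' Ntot).op (k + 1)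
          (duhamelTerm (hsHierarchyModel (d := d) hε hε' Ntot).transport (hsHierarchyModel hε hε' Ntot).op
              m (k + 1 + 1) y.1 (fun a => f a 0) +
            (hsHierarchyModel (d := d) hε hε' Ntot).remainderTerm f (m + 1) (k + 1 + 1) y.1) y.2) :
    ∀ᵐ y : ℝ × Config k d (UnitAddTorus d) ∂((volume : Measure ℝ).prod volume), 0 < y.1 →
      (hsHierarchyModel (d := d) hε hε' Ntot).op k
          ((hsHierarchyModel (d := d) hε hε' Ntot).remainderTerm f (m + 1) (k + 1) y.1) y.2 =
        (hsHierarchyModel (d := d) hε hε' Ntot).op k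
          (duhamelTerm (hsHierarchyModel (d := d) hε hε' Ntot).transport (hsHierarchyModel hε hε' Ntot).op
              (m + 1) (k + 1) y.1 (fun a => f a 0) +
            (hsHierarchyModel (d := d) hε hε' Ntot).remainderTerm f (m + 1 + 1) (k + 1) y.1) y.2 := by
  set M := hsHierarchyModel (d := d) hε hε' Ntot with hM
  set F₀ : GCState d (UnitAddTorus d) := fun a => f a 0 with hF₀
  haveI : IsFiniteMeasure (sphereMeasure (E := EuclideanSpace ℝ d)) :=
    Literature.Analysis.FluidPDE.isFiniteMeasure_sphereMeasure
  have hF₀ : ∀ a, IsNice (F₀ a) := fun a => (hfT a 0).isNice ⟨le_rfl, le_rfl⟩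
  -- the two collision sources at level `k + 1`
  set K₁ : ℝ × Config (k + 1) d (UnitAddTorus d) → ℝ := fun y =>
    M.op (k + 1) (M.remainderTerm f m (k + 1 + 1) y.1) y.2 with hK₁
  set K₂ : ℝ × Config (k + 1) d (UnitAddTorus d) → ℝ := fun y =>
    M.op (k + 1) (duhamelTerm M.transport M.op m (k + 1 + 1) y.1 F₀ + M.remainderTerm f (m + 1) (k + 1 + 1) y.1) y.2 with hK₂
  have ih' : ∀ᵐ y : ℝ × Config (k + 1) d (UnitAddTorus d) ∂((volume : Measure ℝ).prod volume),
      0 < y.1 → K₁ y = K₂ y := ih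
  have hG := fun i => ae_transfer_along_pullback (K₁ := K₁) (K₂ := K₂) ih' (measurableSet_gainParams (ε := ε) k i) (hCg k i)
  have hL := fun i => ae_transfer_along_pullback (K₁ := K₁) (K₂ := K₂) ih' (measurableSet_lossParams (ε := ε) k i) (hCl k i)
  have hall := ae_all_iff.2 fun i => (hG i).and (hL i)
  filter_upwards [hall] with y hy hτ
  -- vanishing off the domain
  have hv₁ : ∀ W ∉ hardSphereDomain (Literature.Analysis.FluidPDE.Torus.geometry d) (k + 1) ε,
      M.remainderTerm f (m + 1) (k + 1) y.1 W = 0 :=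
    fun W hW => remainderTerm_hs_eq_zero_of_not_mem hε hε' Ntot hfD (m + 1) (k + 1) y.1 W hW
  have hv₂ : ∀ W ∉ hardSphereDomain (Literature.Analysis.FluidPDE.Torus.geometry d) (k + 1) ε,
      (duhamelTerm M.transport M.op (m + 1) (k + 1) y.1 F₀ + M.remainderTerm f (m + 1 + 1) (k + 1) y.1) W = 0 := by
    intro W hW
    rw [Pi.add_apply, duhamelTerm_hsHierarchyModel_eq_zero_of_not_mem hε hε' Ntot (fun a Z hZ => hfD a 0 Z hZ) (m + 1) (k + 1)
      y.1 W hW, remainderTerm_hs_eq_zero_of_not_mem hε hε' Ntot hfD (m + 1 + 1) (k + 1) y.1 W hW, add_zero]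
  -- niceness for the additivity of the Duhamel step
  have hn₁ : IsNiceT y.1 (fun t => duhamelTerm M.transport M.op m (k + 1 + 1) t F₀) := isNiceT_duhamelTerm M hF₀ m (k + 1 + 1)
  have hn₂ : IsNiceT y.1 (fun t => M.remainderTerm f (m + 1) (k + 1 + 1) t) :=
    HierarchyModel.isNiceT_remainderTerm M hfT (m + 1) (k + 1 + 1) y.1
  have hsplit : ∀ W : Config (k + 1) d (UnitAddTorus d),
      (duhamelTerm M.transport M.op (m + 1) (k + 1) y.1 F₀ + M.remainderTerm f (m + 1 + 1) (k + 1) y.1) W =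
        ∫ τ' in (0 : ℝ)..y.1, M.transport (k + 1) (y.1 - τ')
          (M.op (k + 1) (duhamelTerm M.transport M.op m (k + 1 + 1) τ' F₀ + M.remainderTerm f (m + 1) (k + 1 + 1) τ')) W := by
    intro W
    rw [Pi.add_apply, duhamelTerm_succ, HierarchyModel.remainderTerm_succ,
      ← duhamelStep_add M hn₁ hn₂ ⟨hτ.le, le_rfl⟩ W]
  have hne : ∀ᵐ τ' : ℝ, τ' ≠ y.1 :=
    (measure_eq_zero_iff_ae_notMem.1 (measure_singleton y.1)).mono fun x hx => by simpa using hx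
  refine outBbgkyOp_congr_of_ae Ntot hv₁ hv₂ fun i => ?_
  obtain ⟨hyG, hyL⟩ := hy i
  filter_upwards [hyG, hyL] with q hqG hqL
  constructor
  · intro hb hD
    rw [hsplit, HierarchyModel.remainderTerm_succ]
    refine intervalIntegral.integral_congr_ae ?_
    filter_upwards [hqG, hne] with τ' hτ' hτ'ne hI
    rw [uIoc_of_le hτ.le] at hI
    have h0 : 0 < y.1 - τ' := sub_pos.2 (lt_of_le_of_ne hI.2 hτ'ne)
    exact hτ' ⟨h0, hb, hD⟩ hI.1
  · intro hb hD
    rw [hsplit, HierarchyModel.remainderTerm_succ]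
    refine intervalIntegral.integral_congr_ae ?_
    filter_upwards [hqL, hne] with τ' hτ' hτ'ne hI
    rw [uIoc_of_le hτ.le] at hI
    have h0 : 0 < y.1 - τ' := sub_pos.2 (lt_of_le_of_ne hI.2 hτ'ne)
    exact hτ' ⟨h0, hb, hD⟩ hI.1

/-- **The source induction**: for every order `n` and level `k`, for `dτ dY`-a.e. `(τ, Y)` with
`τ > 0`, `C^{out}_k R_n^{(k+1)}(τ) (Y) = C^{out}_k [Q_{k+1,k+1+n}(τ) f(0) + R_{n+1}^{(k+1)}(τ)](Y)`
(`hs_remainderSource_ae_eq_zero`, `hs_remainderSource_ae_eq_succ`). [cite: BodineauGallagherSaintRaymondInvent2016, §3.1 Remark 3.1, p. 9] -/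
theorem hs_remainderSource_ae_eq (hCg : GainPullback (d := d) ε) (hCl : LossPullback (d := d) ε)
    (hfT : ∀ (k : ℕ) (T : ℝ), IsNiceT T (f k))
    (hfD : ∀ (k : ℕ) (t : ℝ), ∀ Z ∉ hardSphereDomain (Literature.Analysis.FluidPDE.Torus.geometry d) k ε, f k t Z = 0)
    (hH : ∀ (k : ℕ) (i : Fin k), ∀ᵐ p : (ℝ × Config k d (UnitAddTorus d)) × (sphere (0 : EuclideanSpace ℝ d) 1 × EuclideanSpace ℝ d)
        ∂(((volume : Measure ℝ).prod (volume : Measure (Config k d (UnitAddTorus d)))).prod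
          ((sphereMeasure (E := EuclideanSpace ℝ d)).prod (volume : Measure (EuclideanSpace ℝ d)))),
      (0 < p.1.1 → 0 < ⟪(p.2.1 : EuclideanSpace ℝ d), p.2.2 - (p.1.2 i).2⟫_ℝ →
        gainConfig (Literature.Analysis.FluidPDE.Torus.geometry d) ε p.1.2 i p.2.1 p.2.2 ∈
          hardSphereDomain (Literature.Analysis.FluidPDE.Torus.geometry d) (k + 1) ε →
        f (k + 1) p.1.1 (outRep (Literature.Analysis.FluidPDE.Torus.geometry d) k i
            (gainConfig (Literature.Analysis.FluidPDE.Torus.geometry d) ε p.1.2 i p.2.1 p.2.2)) =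
          (hsHierarchyModel (d := d) hε hε' Ntot).transport (k + 1) p.1.1 (f (k + 1) 0)
              (outRep (Literature.Analysis.FluidPDE.Torus.geometry d) k i
                (gainConfig (Literature.Analysis.FluidPDE.Torus.geometry d) ε p.1.2 i p.2.1 p.2.2)) +
            ∫ τ' in (0 : ℝ)..p.1.1, (hsHierarchyModel (d := d) hε hε' Ntot).transport (k + 1) (p.1.1 - τ')
              ((hsHierarchyModel (d := d) hε hε' Ntot).op (k + 1) (f (k + 1 + 1) τ'))
              (outRep (Literature.Analysis.FluidPDE.Torus.geometry d) k i
                (gainConfig (Literature.Analysis.FluidPDE.Torus.geometry d) ε p.1.2 i p.2.1 p.2.2))) ∧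
      (0 < p.1.1 → ⟪(p.2.1 : EuclideanSpace ℝ d), p.2.2 - (p.1.2 i).2⟫_ℝ < 0 →
        lossConfig (Literature.Analysis.FluidPDE.Torus.geometry d) ε p.1.2 i p.2.1 p.2.2 ∈
          hardSphereDomain (Literature.Analysis.FluidPDE.Torus.geometry d) (k + 1) ε →
        f (k + 1) p.1.1 (outRep (Literature.Analysis.FluidPDE.Torus.geometry d) k i
            (lossConfig (Literature.Analysis.FluidPDE.Torus.geometry d) ε p.1.2 i p.2.1 p.2.2)) =
          (hsHierarchyModel (d := d) hε hε' Ntot).transport (k + 1) p.1.1 (f (k + 1) 0)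
              (outRep (Literature.Analysis.FluidPDE.Torus.geometry d) k i
                (lossConfig (Literature.Analysis.FluidPDE.Torus.geometry d) ε p.1.2 i p.2.1 p.2.2)) +
            ∫ τ' in (0 : ℝ)..p.1.1, (hsHierarchyModel (d := d) hε hε' Ntot).transport (k + 1) (p.1.1 - τ')
              ((hsHierarchyModel (d := d) hε hε' Ntot).op (k + 1) (f (k + 1 + 1) τ'))
              (outRep (Literature.Analysis.FluidPDE.Torus.geometry d) k i
                (lossConfig (Literature.Analysis.FluidPDE.Torus.geometry d) ε p.1.2 i p.2.1 p.2.2))))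
    (n : ℕ) :
    ∀ k : ℕ, ∀ᵐ y : ℝ × Config k d (UnitAddTorus d) ∂((volume : Measure ℝ).prod volume), 0 < y.1 →
      (hsHierarchyModel (d := d) hε hε' Ntot).op k ((hsHierarchyModel (d := d) hε hε' Ntot).remainderTerm f n (k + 1) y.1) y.2 =
        (hsHierarchyModel (d := d) hε hε' Ntot).op k
          (duhamelTerm (hsHierarchyModel (d := d) hε hε' Ntot).transport (hsHierarchyModel hε hε' Ntot).op
              n (k + 1) y.1 (fun a => f a 0) +
            (hsHierarchyModel (d := d) hε hε' Ntot).remainderTerm f (n + 1) (k + 1) y.1) y.2 := by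
  induction n with
  | zero => intro k; exact hs_remainderSource_ae_eq_zero hε hε' Ntot hfD hH k
  | succ m ih => intro k; exact hs_remainderSource_ae_eq_succ hε hε' Ntot hCg hCl hfT hfD m k (ih (k + 1))

/-! ## §4. (S) from (H1) and (H1♯) -/

/-- **One substitution of the hierarchy into itself, almost everywhere**: for every order `n`,
level `s` and `t ≥ 0`, `R_n^{(s)}(t) = Q_{s,s+n}(t) f(0) + R_{n+1}^{(s)}(t)` Lebesgue-a.e. At `n = 0`
this is (H1); at `n = m + 1` the collision sources agree a.e. (`hs_remainderSource_ae_eq`) and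
`(Z, τ) ↦ (τ, Φ_{τ-t} Z)` preserves the product measure (`measurePreserving_time_regFlow`), then
`duhamelStep_add`. [cite: BodineauGallagherSaintRaymondInvent2016, §3.1, p. 9] -/
theorem hs_remainderTerm_ae_eq (hCg : GainPullback (d := d) ε) (hCl : LossPullback (d := d) ε)
    (hfT : ∀ (k : ℕ) (T : ℝ), IsNiceT T (f k))
    (hfD : ∀ (k : ℕ) (t : ℝ), ∀ Z ∉ hardSphereDomain (Literature.Analysis.FluidPDE.Torus.geometry d) k ε, f k t Z = 0)
    (hH1 : ∀ (k : ℕ) (t : ℝ), 0 ≤ t → ∀ᵐ Z : Config k d (UnitAddTorus d),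
      f k t Z = (hsHierarchyModel (d := d) hε hε' Ntot).transport k t (f k 0) Z +
        ∫ τ in (0 : ℝ)..t, (hsHierarchyModel (d := d) hε hε' Ntot).transport k (t - τ)
          ((hsHierarchyModel (d := d) hε hε' Ntot).op k (f (k + 1) τ)) Z)
    (hH : ∀ (k : ℕ) (i : Fin k), ∀ᵐ p : (ℝ × Config k d (UnitAddTorus d)) × (sphere (0 : EuclideanSpace ℝ d) 1 × EuclideanSpace ℝ d)
        ∂(((volume : Measure ℝ).prod (volume : Measure (Config k d (UnitAddTorus d)))).prod
          ((sphereMeasure (E := EuclideanSpace ℝ d)).prod (volume : Measure (EuclideanSpace ℝ d)))),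
      (0 < p.1.1 → 0 < ⟪(p.2.1 : EuclideanSpace ℝ d), p.2.2 - (p.1.2 i).2⟫_ℝ →
        gainConfig (Literature.Analysis.FluidPDE.Torus.geometry d) ε p.1.2 i p.2.1 p.2.2 ∈
          hardSphereDomain (Literature.Analysis.FluidPDE.Torus.geometry d) (k + 1) ε →
        f (k + 1) p.1.1 (outRep (Literature.Analysis.FluidPDE.Torus.geometry d) k i
            (gainConfig (Literature.Analysis.FluidPDE.Torus.geometry d) ε p.1.2 i p.2.1 p.2.2)) =
          (hsHierarchyModel (d := d) hε hε' Ntot).transport (k + 1) p.1.1 (f (k + 1) 0)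
              (outRep (Literature.Analysis.FluidPDE.Torus.geometry d) k i
                (gainConfig (Literature.Analysis.FluidPDE.Torus.geometry d) ε p.1.2 i p.2.1 p.2.2)) +
            ∫ τ' in (0 : ℝ)..p.1.1, (hsHierarchyModel (d := d) hε hε' Ntot).transport (k + 1) (p.1.1 - τ')
              ((hsHierarchyModel (d := d) hε hε' Ntot).op (k + 1) (f (k + 1 + 1) τ'))
              (outRep (Literature.Analysis.FluidPDE.Torus.geometry d) k i
                (gainConfig (Literature.Analysis.FluidPDE.Torus.geometry d) ε p.1.2 i p.2.1 p.2.2))) ∧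
      (0 < p.1.1 → ⟪(p.2.1 : EuclideanSpace ℝ d), p.2.2 - (p.1.2 i).2⟫_ℝ < 0 →
        lossConfig (Literature.Analysis.FluidPDE.Torus.geometry d) ε p.1.2 i p.2.1 p.2.2 ∈
          hardSphereDomain (Literature.Analysis.FluidPDE.Torus.geometry d) (k + 1) ε →
        f (k + 1) p.1.1 (outRep (Literature.Analysis.FluidPDE.Torus.geometry d) k i
            (lossConfig (Literature.Analysis.FluidPDE.Torus.geometry d) ε p.1.2 i p.2.1 p.2.2)) =
          (hsHierarchyModel (d := d) hε hε' Ntot).transport (k + 1) p.1.1 (f (k + 1) 0)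
              (outRep (Literature.Analysis.FluidPDE.Torus.geometry d) k i
                (lossConfig (Literature.Analysis.FluidPDE.Torus.geometry d) ε p.1.2 i p.2.1 p.2.2)) +
            ∫ τ' in (0 : ℝ)..p.1.1, (hsHierarchyModel (d := d) hε hε' Ntot).transport (k + 1) (p.1.1 - τ')
              ((hsHierarchyModel (d := d) hε hε' Ntot).op (k + 1) (f (k + 1 + 1) τ'))
              (outRep (Literature.Analysis.FluidPDE.Torus.geometry d) k i
                (lossConfig (Literature.Analysis.FluidPDE.Torus.geometry d) ε p.1.2 i p.2.1 p.2.2))))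
    (n s : ℕ) {t : ℝ} (ht : 0 ≤ t) :
    ∀ᵐ Z : Config s d (UnitAddTorus d),
      (hsHierarchyModel (d := d) hε hε' Ntot).remainderTerm f n s t Z =
        duhamelTerm (hsHierarchyModel (d := d) hε hε' Ntot).transport (hsHierarchyModel hε hε' Ntot).op n s t
            (fun a => f a 0) Z +
          (hsHierarchyModel (d := d) hε hε' Ntot).remainderTerm f (n + 1) s t Z := by
  set M := hsHierarchyModel (d := d) hε hε' Ntot with hM
  set F₀ : GCState d (UnitAddTorus d) := fun a => f a 0 with hF₀
  have hF₀ : ∀ a, IsNice (F₀ a) := fun a => (hfT a 0).isNice ⟨le_rfl, le_rfl⟩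
  cases n with
  | zero =>
    filter_upwards [hH1 s t ht] with Z hZ
    rw [HierarchyModel.remainderTerm_zero, duhamelTerm_zero, HierarchyModel.remainderTerm_one]
    exact hZ
  | succ m =>
    have hsrc := hs_remainderSource_ae_eq hε hε' Ntot hCg hCl hfT hfD hH m s
    have h1 := (measurePreserving_time_regFlow (d := d) hε hε' (s := s) t).quasiMeasurePreserving.ae hsrc
    have hn₁ : IsNiceT t (fun τ => duhamelTerm M.transport M.op m (s + 1) τ F₀) := isNiceT_duhamelTerm M hF₀ m (s + 1)
    have hn₂ : IsNiceT t (fun τ => M.remainderTerm f (m + 1) (s + 1) τ) :=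
      HierarchyModel.isNiceT_remainderTerm M hfT (m + 1) (s + 1) t
    filter_upwards [Measure.ae_ae_of_ae_prod h1] with Z hZ
    rw [HierarchyModel.remainderTerm_succ, duhamelTerm_succ, HierarchyModel.remainderTerm_succ,
      ← duhamelStep_add M hn₁ hn₂ ⟨ht, le_rfl⟩ Z]
    refine intervalIntegral.integral_congr_ae ?_
    filter_upwards [hZ] with τ hτ hI
    rw [uIoc_of_le ht] at hI
    simp only [HierarchyModel.transport_apply]
    rw [show -(t - τ) = τ - t from neg_sub t τ]
    exact hτ hI.1

/-- **Telescoping**: for every `m`, level `s` and `t ≥ 0`,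
`f^{(s)}(t) = ∑_{n<m} Q_{s,s+n}(t) f(0) + R_m^{(s)}(t)` almost everywhere
(`hs_remainderTerm_ae_eq` summed). [cite: BodineauGallagherSaintRaymondInvent2016, §3.1, p. 9] -/
theorem hs_ae_eq_sum_add_remainderTerm (hCg : GainPullback (d := d) ε) (hCl : LossPullback (d := d) ε)
    (hfT : ∀ (k : ℕ) (T : ℝ), IsNiceT T (f k))
    (hfD : ∀ (k : ℕ) (t : ℝ), ∀ Z ∉ hardSphereDomain (Literature.Analysis.FluidPDE.Torus.geometry d) k ε, f k t Z = 0)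
    (hH1 : ∀ (k : ℕ) (t : ℝ), 0 ≤ t → ∀ᵐ Z : Config k d (UnitAddTorus d),
      f k t Z = (hsHierarchyModel (d := d) hε hε' Ntot).transport k t (f k 0) Z +
        ∫ τ in (0 : ℝ)..t, (hsHierarchyModel (d := d) hε hε' Ntot).transport k (t - τ)
          ((hsHierarchyModel (d := d) hε hε' Ntot).op k (f (k + 1) τ)) Z)
    (hH : ∀ (k : ℕ) (i : Fin k), ∀ᵐ p : (ℝ × Config k d (UnitAddTorus d)) × (sphere (0 : EuclideanSpace ℝ d) 1 × EuclideanSpace ℝ d)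
        ∂(((volume : Measure ℝ).prod (volume : Measure (Config k d (UnitAddTorus d)))).prod
          ((sphereMeasure (E := EuclideanSpace ℝ d)).prod (volume : Measure (EuclideanSpace ℝ d)))),
      (0 < p.1.1 → 0 < ⟪(p.2.1 : EuclideanSpace ℝ d), p.2.2 - (p.1.2 i).2⟫_ℝ →
        gainConfig (Literature.Analysis.FluidPDE.Torus.geometry d) ε p.1.2 i p.2.1 p.2.2 ∈
          hardSphereDomain (Literature.Analysis.FluidPDE.Torus.geometry d) (k + 1) ε →
        f (k + 1) p.1.1 (outRep (Literature.Analysis.FluidPDE.Torus.geometry d) k i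
            (gainConfig (Literature.Analysis.FluidPDE.Torus.geometry d) ε p.1.2 i p.2.1 p.2.2)) =
          (hsHierarchyModel (d := d) hε hε' Ntot).transport (k + 1) p.1.1 (f (k + 1) 0)
              (outRep (Literature.Analysis.FluidPDE.Torus.geometry d) k i
                (gainConfig (Literature.Analysis.FluidPDE.Torus.geometry d) ε p.1.2 i p.2.1 p.2.2)) +
            ∫ τ' in (0 : ℝ)..p.1.1, (hsHierarchyModel (d := d) hε hε' Ntot).transport (k + 1) (p.1.1 - τ')
              ((hsHierarchyModel (d := d) hε hε' Ntot).op (k + 1) (f (k + 1 + 1) τ'))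
              (outRep (Literature.Analysis.FluidPDE.Torus.geometry d) k i
                (gainConfig (Literature.Analysis.FluidPDE.Torus.geometry d) ε p.1.2 i p.2.1 p.2.2))) ∧
      (0 < p.1.1 → ⟪(p.2.1 : EuclideanSpace ℝ d), p.2.2 - (p.1.2 i).2⟫_ℝ < 0 →
        lossConfig (Literature.Analysis.FluidPDE.Torus.geometry d) ε p.1.2 i p.2.1 p.2.2 ∈
          hardSphereDomain (Literature.Analysis.FluidPDE.Torus.geometry d) (k + 1) ε →
        f (k + 1) p.1.1 (outRep (Literature.Analysis.FluidPDE.Torus.geometry d) k i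
            (lossConfig (Literature.Analysis.FluidPDE.Torus.geometry d) ε p.1.2 i p.2.1 p.2.2)) =
          (hsHierarchyModel (d := d) hε hε' Ntot).transport (k + 1) p.1.1 (f (k + 1) 0)
              (outRep (Literature.Analysis.FluidPDE.Torus.geometry d) k i
                (lossConfig (Literature.Analysis.FluidPDE.Torus.geometry d) ε p.1.2 i p.2.1 p.2.2)) +
            ∫ τ' in (0 : ℝ)..p.1.1, (hsHierarchyModel (d := d) hε hε' Ntot).transport (k + 1) (p.1.1 - τ')
              ((hsHierarchyModel (d := d) hε hε' Ntot).op (k + 1) (f (k + 1 + 1) τ'))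
              (outRep (Literature.Analysis.FluidPDE.Torus.geometry d) k i
                (lossConfig (Literature.Analysis.FluidPDE.Torus.geometry d) ε p.1.2 i p.2.1 p.2.2))))
    (m s : ℕ) {t : ℝ} (ht : 0 ≤ t) :
    ∀ᵐ Z : Config s d (UnitAddTorus d),
      f s t Z = (∑ n ∈ Finset.range m,
          duhamelTerm (hsHierarchyModel (d := d) hε hε' Ntot).transport (hsHierarchyModel hε hε' Ntot).op n s t
            (fun a => f a 0) Z) +
        (hsHierarchyModel (d := d) hε hε' Ntot).remainderTerm f m s t Z := by
  induction m with
  | zero =>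
    exact ae_of_all _ fun Z => by simp [HierarchyModel.remainderTerm_zero]
  | succ m ih =>
    have h := hs_remainderTerm_ae_eq hε hε' Ntot hCg hCl hfT hfD hH1 hH m s ht
    filter_upwards [ih, h] with Z hZ hZ'
    rw [hZ, hZ', Finset.sum_range_succ]
    ring

/-- **The iterated Duhamel formula up to null sets ((S)) from the one-step hierarchy at generic
and at contact configurations.** Let `f^{(k)}(t)` be a jointly measurable, Gaussian-bounded
family on the hard-sphere phase spaces over `T^d` (`0 < ε < 1/2`), vanishing above the level
`Nmax` and off the hard-sphere domains, which satisfies the one-step integrated hierarchy of the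
`Ntot`-sphere model (H1) at Lebesgue-almost every configuration and (H1♯) at the outgoing adjoined
contact configurations read by the collision operators (almost every time, configuration, impact
direction and velocity). Assume the transported adjunctions are non-singular (`GainPullback`,
`LossPullback`; `HardSphereAdjunctionPullback`). Then for every level `s` and `t ≥ 0` the finite
Duhamel series of `f(0)` is a version of `f^{(s)}(t)`:
`(hsHierarchyModel hε hε' Ntot).seriesFamily Nmax (f · 0) s t = f^{(s)}(t)` Lebesgue-a.e.
(telescoping `hs_ae_eq_sum_add_remainderTerm` at `m = Nmax + 1`, where the remainder vanishes).
BGSR §3.1: "the iterated Duhamel formula"; CIP (4.7) "for almost all `z^s`".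
[cite: BodineauGallagherSaintRaymondInvent2016, §3.1 and Remark 3.1, p. 9] -/
theorem hs_seriesFamily_ae_eq_of_oneStep (hCg : GainPullback (d := d) ε) (hCl : LossPullback (d := d) ε)
    {Nmax : ℕ} (hfT : ∀ (k : ℕ) (T : ℝ), IsNiceT T (f k))
    (hfD : ∀ (k : ℕ) (t : ℝ), ∀ Z ∉ hardSphereDomain (Literature.Analysis.FluidPDE.Torus.geometry d) k ε, f k t Z = 0)
    (hfN : ∀ k, Nmax < k → ∀ t, f k t = 0)
    (hH1 : ∀ (k : ℕ) (t : ℝ), 0 ≤ t → ∀ᵐ Z : Config k d (UnitAddTorus d),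
      f k t Z = (hsHierarchyModel (d := d) hε hε' Ntot).transport k t (f k 0) Z +
        ∫ τ in (0 : ℝ)..t, (hsHierarchyModel (d := d) hε hε' Ntot).transport k (t - τ)
          ((hsHierarchyModel (d := d) hε hε' Ntot).op k (f (k + 1) τ)) Z)
    (hH : ∀ (k : ℕ) (i : Fin k), ∀ᵐ p : (ℝ × Config k d (UnitAddTorus d)) × (sphere (0 : EuclideanSpace ℝ d) 1 × EuclideanSpace ℝ d)
        ∂(((volume : Measure ℝ).prod (volume : Measure (Config k d (UnitAddTorus d)))).prod
          ((sphereMeasure (E := EuclideanSpace ℝ d)).prod (volume : Measure (EuclideanSpace ℝ d)))),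
      (0 < p.1.1 → 0 < ⟪(p.2.1 : EuclideanSpace ℝ d), p.2.2 - (p.1.2 i).2⟫_ℝ →
        gainConfig (Literature.Analysis.FluidPDE.Torus.geometry d) ε p.1.2 i p.2.1 p.2.2 ∈
          hardSphereDomain (Literature.Analysis.FluidPDE.Torus.geometry d) (k + 1) ε →
        f (k + 1) p.1.1 (outRep (Literature.Analysis.FluidPDE.Torus.geometry d) k i
            (gainConfig (Literature.Analysis.FluidPDE.Torus.geometry d) ε p.1.2 i p.2.1 p.2.2)) =
          (hsHierarchyModel (d := d) hε hε' Ntot).transport (k + 1) p.1.1 (f (k + 1) 0)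
              (outRep (Literature.Analysis.FluidPDE.Torus.geometry d) k i
                (gainConfig (Literature.Analysis.FluidPDE.Torus.geometry d) ε p.1.2 i p.2.1 p.2.2)) +
            ∫ τ' in (0 : ℝ)..p.1.1, (hsHierarchyModel (d := d) hε hε' Ntot).transport (k + 1) (p.1.1 - τ')
              ((hsHierarchyModel (d := d) hε hε' Ntot).op (k + 1) (f (k + 1 + 1) τ'))
              (outRep (Literature.Analysis.FluidPDE.Torus.geometry d) k i
                (gainConfig (Literature.Analysis.FluidPDE.Torus.geometry d) ε p.1.2 i p.2.1 p.2.2))) ∧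
      (0 < p.1.1 → ⟪(p.2.1 : EuclideanSpace ℝ d), p.2.2 - (p.1.2 i).2⟫_ℝ < 0 →
        lossConfig (Literature.Analysis.FluidPDE.Torus.geometry d) ε p.1.2 i p.2.1 p.2.2 ∈
          hardSphereDomain (Literature.Analysis.FluidPDE.Torus.geometry d) (k + 1) ε →
        f (k + 1) p.1.1 (outRep (Literature.Analysis.FluidPDE.Torus.geometry d) k i
            (lossConfig (Literature.Analysis.FluidPDE.Torus.geometry d) ε p.1.2 i p.2.1 p.2.2)) =
          (hsHierarchyModel (d := d) hε hε' Ntot).transport (k + 1) p.1.1 (f (k + 1) 0)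
              (outRep (Literature.Analysis.FluidPDE.Torus.geometry d) k i
                (lossConfig (Literature.Analysis.FluidPDE.Torus.geometry d) ε p.1.2 i p.2.1 p.2.2)) +
            ∫ τ' in (0 : ℝ)..p.1.1, (hsHierarchyModel (d := d) hε hε' Ntot).transport (k + 1) (p.1.1 - τ')
              ((hsHierarchyModel (d := d) hε hε' Ntot).op (k + 1) (f (k + 1 + 1) τ'))
              (outRep (Literature.Analysis.FluidPDE.Torus.geometry d) k i
                (lossConfig (Literature.Analysis.FluidPDE.Torus.geometry d) ε p.1.2 i p.2.1 p.2.2))))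
    (s : ℕ) {t : ℝ} (ht : 0 ≤ t) :
    (hsHierarchyModel (d := d) hε hε' Ntot).seriesFamily Nmax (fun a => f a 0) s t =ᵐ[volume] f s t := by
  have h := hs_ae_eq_sum_add_remainderTerm hε hε' Ntot hCg hCl hfT hfD hH1 hH (Nmax + 1) s ht
  have h0 : (hsHierarchyModel (d := d) hε hε' Ntot).remainderTerm f (Nmax + 1) s t = 0 :=
    HierarchyModel.remainderTerm_eq_zero_of_lt _ hfN (Nmax + 1) s t (by omega)
  filter_upwards [h] with Z hZ
  rw [HierarchyModel.seriesFamily_apply, hZ, h0, Pi.zero_apply, add_zero]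

end HardSpheres

end Kinetic

end

end Literature.MathematicalPhysics.KineticTheory
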